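import Summits.QuantumFields.YangMills.Theorems.ColdStartUniversalityLatticeLangevinTransportMixingOfLogSobolev
import HarnessLib

/-!
# Route `ColdStartUniversality` (fixed-cut-off package): TRANSPORT–ENTROPY MIXING FROM LOG-SOBOLEV(`ρ`) — log-mgf, concentration, transport
# inequality and COLD-START EQUILIBRATION OF SMOOTH OBSERVABLES at every coupling `β'`

Helper file (seat `ym-line-csu-p1`, g28; `--supports stmt-QuantumFields-24809`), sequel of `…TransportMixingOfLogSobolev` (hypothesis: a generator-form
log-Sobolev inequality `ρ·Ent_(μ_β')(F²) ≤ −∫F·𝓛_(β')f dμ_(β')` on `C³` cylinders, `ρ > 0`; `f ∈ C³` with carré du champ `Γ(f) ≤ s`):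
* ★ `wilson_logmgf_le_of_logSobolev` — `log ∫ e^(λ(F − μF)) dμ_(β') ≤ (s/(4ρ))·λ²/2`, every real `λ`;
* ★ `wilson_concentration_of_logSobolev` — `μ_(β'){F ≥ μF + r} ≤ exp(−2ρr²/s)`;
* ★★ `wilson_transport_le_sqrt_of_logSobolev` — `|∫F dν − ∫F dμ_(β')| ≤ √(s·KL(ν ‖ μ_(β'))/(2ρ))` [cite: BoucheronLugosiMassart2013, Lemma 4.18];
* ★★★ `wilson_coldStart_smooth_le_exp_of_logSobolev` — for EVERY solution of the SZZ dynamics from a deterministic start, `τ₀ > 0`, `u ≥ 0`: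
  `|E F(U_(τ₀+u)) − μ_(β')F| ≤ e^(−2ρu) · √(s · KL(law U_(τ₀) ‖ μ_(β'))/(2ρ))` (g22's KL decay `e^(−4ρu)` [cite: BakryGentilLedoux2014, Thm 5.2.1]);
* ★★★ `wilson_coldStart_smooth_le_exp_of_logSobolev_explicit` — with g27's explicit budget (`τ₀ = 2`, EVERY `β'`):
  `≤ e^(−2ρu) · √(s · B_L/(2ρ))`, `B_L = 366|β'|L³ + 3 log(3/2) L³ + log 2`.
Why: at the cut-off coupling with `ρ = c·ε_K` the hypothesis is the inner statement of the route's K-uniform (ULS) of LINE 4 «cold_entropy», and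
`s·B_L = O(β'_K)` for spatial averages — so (ULS) ALONE yields cold-start equilibration of averaged Wilson loops in physical time `O(log(1/ε_K))`
(companion `…UniformColdStartMixingNearUniformOfLogSobolev`), bypassing the K-uniform entropy-budget stub up to a logarithm.
HONEST FRAMING: FIXED cut-off; the log-Sobolev inequality is a HYPOTHESIS; nothing K-uniform; 24809 ASIDE not restated; no crux, rung or summit statement
is proved; the Yang–Mills mass gap is NOT proved.  THEOREMS ONLY, no definition, no sorry.
-/

set_option autoImplicit false

noncomputable section

namespace Summit.QuantumFields.YangMills.Theorems.ColdStartUniversality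

open MeasureTheory ProbabilityTheory Finset Filter Set Metric InformationTheory
open scoped BigOperators NNReal ENNReal Topology
open Literature.Probability.Process Literature.MathematicalPhysics.QuantumFieldTheory
open Literature.MathematicalPhysics.QuantumLattice (fundamentalRep fundamentalLatticeRep continuous_fundamentalRep)

variable {L : ℕ} [NeZero L]

/-! ## §1. Log-mgf and concentration -/

/-- ★ **Sub-Gaussian log-moment generating function from log-Sobolev(`ρ`)**: for every real `λ`,
`log ∫ exp(λ(F − ∫F dμ_(β'))) dμ_(β') ≤ (s/(4ρ))·λ²/2` (variance proxy `v = s/(4ρ)`). [folklore] -/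
theorem wilson_logmgf_le_of_logSobolev (L : ℕ) [NeZero L] (β' : ℝ) {ρ : ℝ} (hρ : 0 < ρ) (s : ℝ)
    (f : (Edge 3 L × Fin 2 × Fin 2 × Bool → ℝ) → ℝ) (hf : ContDiff ℝ 3 f)
    (hLSgen : ∀ (f : (Edge 3 L × Fin 2 × Fin 2 × Bool → ℝ) → ℝ), ContDiff ℝ 3 f →
        let coords : GaugeConfig 3 L (Matrix.specialUnitaryGroup (Fin 2) ℂ) → (Edge 3 L × Fin 2 × Fin 2 × Bool → ℝ) :=
          fun V q => (fun z : ℂ => if q.2.2.2 then z.im else z.re)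
            ((fundamentalRep (Fin 2) (V q.1) : Matrix (Fin 2) (Fin 2) ℂ) q.2.1 q.2.2.1)
        let gen : GaugeConfig 3 L (Matrix.specialUnitaryGroup (Fin 2) ℂ) → ℝ := fun V =>
          (∑ i : Edge 3 L × Fin 2 × Fin 2 × Bool, fderiv ℝ f (coords V) (Pi.single i 1) *
              (fun z : ℂ => if i.2.2.2 then z.im else z.re)
                ((latticeLangevinDynamics (fundamentalLatticeRep 2) β').drift
                  (matrixConfig (fundamentalRep (Fin 2)) V) i.1 i.2.1 i.2.2.1) +
          1 / 2 * ∑ i : Edge 3 L × Fin 2 × Fin 2 × Bool, ∑ j : Edge 3 L × Fin 2 × Fin 2 × Bool,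
            fderiv ℝ (fun z => fderiv ℝ f z (Pi.single i 1)) (coords V) (Pi.single j 1) *
              ∑ n : Edge 3 L × NoiseIdx 2,
                (if n.1 = i.1 then (fun z : ℂ => if i.2.2.2 then z.im else z.re)
                  ((latticeLangevinDynamics (fundamentalLatticeRep 2) β').noise
                    (matrixConfig (fundamentalRep (Fin 2)) V) i.1 n.2 i.2.1 i.2.2.1) else 0) *
                (if n.1 = j.1 then (fun z : ℂ => if j.2.2.2 then z.im else z.re)
                  ((latticeLangevinDynamics (fundamentalLatticeRep 2) β').noise
                    (matrixConfig (fundamentalRep (Fin 2)) V) j.1 n.2 j.2.1 j.2.2.1) else 0))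
        ρ * ((∫ V, f (coords V) ^ 2 * Real.log (f (coords V) ^ 2) ∂(wilsonMeasure (d := 3) (L := L) (fundamentalRep (Fin 2)) β')) -
            (∫ V, f (coords V) ^ 2 ∂(wilsonMeasure (d := 3) (L := L) (fundamentalRep (Fin 2)) β')) *
              Real.log (∫ V, f (coords V) ^ 2 ∂(wilsonMeasure (d := 3) (L := L) (fundamentalRep (Fin 2)) β'))) ≤
          -∫ V, f (coords V) * gen V ∂(wilsonMeasure (d := 3) (L := L) (fundamentalRep (Fin 2)) β')) :
    let coords : GaugeConfig 3 L (Matrix.specialUnitaryGroup (Fin 2) ℂ) → (Edge 3 L × Fin 2 × Fin 2 × Bool → ℝ) :=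
      fun V q => (fun z : ℂ => if q.2.2.2 then z.im else z.re)
        ((fundamentalRep (Fin 2) (V q.1) : Matrix (Fin 2) (Fin 2) ℂ) q.2.1 q.2.2.1)
    let A : GaugeConfig 3 L (Matrix.specialUnitaryGroup (Fin 2) ℂ) → (Edge 3 L × Fin 2 × Fin 2 × Bool) →
        (Edge 3 L × Fin 2 × Fin 2 × Bool) → ℝ := fun V i j =>
      ∑ n : Edge 3 L × NoiseIdx 2,
        (if n.1 = i.1 then (fun z : ℂ => if i.2.2.2 then z.im else z.re)
          ((latticeLangevinDynamics (fundamentalLatticeRep 2) β').noise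
            (matrixConfig (fundamentalRep (Fin 2)) V) i.1 n.2 i.2.1 i.2.2.1) else 0) *
        (if n.1 = j.1 then (fun z : ℂ => if j.2.2.2 then z.im else z.re)
          ((latticeLangevinDynamics (fundamentalLatticeRep 2) β').noise
            (matrixConfig (fundamentalRep (Fin 2)) V) j.1 n.2 j.2.1 j.2.2.1) else 0)
    (∀ V, (∑ i : Edge 3 L × Fin 2 × Fin 2 × Bool, ∑ j : Edge 3 L × Fin 2 × Fin 2 × Bool, fderiv ℝ f (coords V) (Pi.single i 1) * fderiv ℝ f (coords V) (Pi.single j 1) * A V i j) ≤ s) → ∀ l : ℝ,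
      Real.log (∫ V, Real.exp (l * (f (coords V) - ∫ V', f (coords V') ∂(wilsonMeasure (d := 3) (L := L) (fundamentalRep (Fin 2)) β'))) ∂(wilsonMeasure (d := 3) (L := L) (fundamentalRep (Fin 2)) β')) ≤
        s / (4 * ρ) * l ^ 2 / 2 := by
  intro coords A hΓ l
  classical
  haveI := secondCountableTopology_su2
  haveI := borelSpace_config L
  set μ : Measure (GaugeConfig 3 L (Matrix.specialUnitaryGroup (Fin 2) ℂ)) := (wilsonMeasure (d := 3) (L := L) (fundamentalRep (Fin 2)) β') with hμ
  haveI : IsProbabilityMeasure μ :=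
    isProbabilityMeasure_wilsonMeasure (d := 3) (L := L) (fundamentalRep (Fin 2)) (continuous_fundamentalRep (Fin 2)) β'
  have hlap := wilson_laplace_le_exp_of_logSobolev_real L β' s f hf hρ hLSgen hΓ l
  have hco : Continuous coords := continuous_coords (L := L)
  have hFc : Continuous fun V => f (coords V) := hf.continuous.comp hco
  set m : ℝ := ∫ V', f (coords V') ∂μ with hm
  have e1 : ∫ V, Real.exp (l * (f (coords V) - m)) ∂μ = Real.exp (-(l * m)) * ∫ V, Real.exp (l * f (coords V)) ∂μ := by
    rw [← integral_const_mul]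
    refine integral_congr_ae (ae_of_all _ fun V => ?_)
    beta_reduce
    rw [← Real.exp_add]
    congr 1; ring
  have hint : Integrable (fun V => Real.exp (l * (f (coords V) - m))) μ :=
    integrable_of_continuous_of_compactSpace (Real.continuous_exp.comp (continuous_const.mul (hFc.sub continuous_const))) _
  have hpos : 0 < ∫ V, Real.exp (l * (f (coords V) - m)) ∂μ := integral_exp_pos hint
  rw [Real.log_le_iff_le_exp hpos, e1]
  calc Real.exp (-(l * m)) * ∫ V, Real.exp (l * f (coords V)) ∂μ
      ≤ Real.exp (-(l * m)) * Real.exp (l * m + s / (8 * ρ) * l ^ 2) :=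
        mul_le_mul_of_nonneg_left hlap (Real.exp_pos _).le
    _ = Real.exp (s / (4 * ρ) * l ^ 2 / 2) := by
        rw [← Real.exp_add]
        congr 1
        field_simp
        ring

/-- ★ **Gaussian concentration from log-Sobolev(`ρ`)**: for `f ∈ C³` with `Γ(f) ≤ s` (`s > 0`) and `r ≥ 0`,
`μ_(β'){V | ∫F dμ_(β') + r ≤ F(V)} ≤ exp(−2ρ·r²/s)`. [folklore] -/
theorem wilson_concentration_of_logSobolev (L : ℕ) [NeZero L] (β' : ℝ)
    (f : (Edge 3 L × Fin 2 × Fin 2 × Bool → ℝ) → ℝ) (hf : ContDiff ℝ 3 f) {s : ℝ} (hs : 0 < s) {ρ : ℝ} (hρ : 0 < ρ)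
    (hLSgen : ∀ (f : (Edge 3 L × Fin 2 × Fin 2 × Bool → ℝ) → ℝ), ContDiff ℝ 3 f →
        let coords : GaugeConfig 3 L (Matrix.specialUnitaryGroup (Fin 2) ℂ) → (Edge 3 L × Fin 2 × Fin 2 × Bool → ℝ) :=
          fun V q => (fun z : ℂ => if q.2.2.2 then z.im else z.re)
            ((fundamentalRep (Fin 2) (V q.1) : Matrix (Fin 2) (Fin 2) ℂ) q.2.1 q.2.2.1)
        let gen : GaugeConfig 3 L (Matrix.specialUnitaryGroup (Fin 2) ℂ) → ℝ := fun V =>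
          (∑ i : Edge 3 L × Fin 2 × Fin 2 × Bool, fderiv ℝ f (coords V) (Pi.single i 1) *
              (fun z : ℂ => if i.2.2.2 then z.im else z.re)
                ((latticeLangevinDynamics (fundamentalLatticeRep 2) β').drift
                  (matrixConfig (fundamentalRep (Fin 2)) V) i.1 i.2.1 i.2.2.1) +
          1 / 2 * ∑ i : Edge 3 L × Fin 2 × Fin 2 × Bool, ∑ j : Edge 3 L × Fin 2 × Fin 2 × Bool,
            fderiv ℝ (fun z => fderiv ℝ f z (Pi.single i 1)) (coords V) (Pi.single j 1) *
              ∑ n : Edge 3 L × NoiseIdx 2,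
                (if n.1 = i.1 then (fun z : ℂ => if i.2.2.2 then z.im else z.re)
                  ((latticeLangevinDynamics (fundamentalLatticeRep 2) β').noise
                    (matrixConfig (fundamentalRep (Fin 2)) V) i.1 n.2 i.2.1 i.2.2.1) else 0) *
                (if n.1 = j.1 then (fun z : ℂ => if j.2.2.2 then z.im else z.re)
                  ((latticeLangevinDynamics (fundamentalLatticeRep 2) β').noise
                    (matrixConfig (fundamentalRep (Fin 2)) V) j.1 n.2 j.2.1 j.2.2.1) else 0))
        ρ * ((∫ V, f (coords V) ^ 2 * Real.log (f (coords V) ^ 2) ∂(wilsonMeasure (d := 3) (L := L) (fundamentalRep (Fin 2)) β')) -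
            (∫ V, f (coords V) ^ 2 ∂(wilsonMeasure (d := 3) (L := L) (fundamentalRep (Fin 2)) β')) *
              Real.log (∫ V, f (coords V) ^ 2 ∂(wilsonMeasure (d := 3) (L := L) (fundamentalRep (Fin 2)) β'))) ≤
          -∫ V, f (coords V) * gen V ∂(wilsonMeasure (d := 3) (L := L) (fundamentalRep (Fin 2)) β')) :
    let coords : GaugeConfig 3 L (Matrix.specialUnitaryGroup (Fin 2) ℂ) → (Edge 3 L × Fin 2 × Fin 2 × Bool → ℝ) :=
      fun V q => (fun z : ℂ => if q.2.2.2 then z.im else z.re)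
        ((fundamentalRep (Fin 2) (V q.1) : Matrix (Fin 2) (Fin 2) ℂ) q.2.1 q.2.2.1)
    let A : GaugeConfig 3 L (Matrix.specialUnitaryGroup (Fin 2) ℂ) → (Edge 3 L × Fin 2 × Fin 2 × Bool) →
        (Edge 3 L × Fin 2 × Fin 2 × Bool) → ℝ := fun V i j =>
      ∑ n : Edge 3 L × NoiseIdx 2,
        (if n.1 = i.1 then (fun z : ℂ => if i.2.2.2 then z.im else z.re)
          ((latticeLangevinDynamics (fundamentalLatticeRep 2) β').noise
            (matrixConfig (fundamentalRep (Fin 2)) V) i.1 n.2 i.2.1 i.2.2.1) else 0) *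
        (if n.1 = j.1 then (fun z : ℂ => if j.2.2.2 then z.im else z.re)
          ((latticeLangevinDynamics (fundamentalLatticeRep 2) β').noise
            (matrixConfig (fundamentalRep (Fin 2)) V) j.1 n.2 j.2.1 j.2.2.1) else 0)
    (∀ V, (∑ i : Edge 3 L × Fin 2 × Fin 2 × Bool, ∑ j : Edge 3 L × Fin 2 × Fin 2 × Bool, fderiv ℝ f (coords V) (Pi.single i 1) * fderiv ℝ f (coords V) (Pi.single j 1) * A V i j) ≤ s) → ∀ r : ℝ, 0 ≤ r →
      ((wilsonMeasure (d := 3) (L := L) (fundamentalRep (Fin 2)) β')).real {V | (∫ V', f (coords V') ∂(wilsonMeasure (d := 3) (L := L) (fundamentalRep (Fin 2)) β')) + r ≤ f (coords V)} ≤ Real.exp (-(2 * ρ * r ^ 2 / s)) := by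
  intro coords A hΓ r hr
  classical
  haveI := secondCountableTopology_su2
  haveI := borelSpace_config L
  haveI : IsProbabilityMeasure (wilsonMeasure (d := 3) (L := L) (fundamentalRep (Fin 2)) β') :=
    isProbabilityMeasure_wilsonMeasure (d := 3) (L := L) (fundamentalRep (Fin 2)) (continuous_fundamentalRep (Fin 2)) β'
  have hco : Continuous coords := continuous_coords (L := L)
  have hFc : Continuous fun V => f (coords V) := hf.continuous.comp hco
  obtain ⟨M, hM⟩ : ∃ M, ∀ V : (GaugeConfig 3 L (Matrix.specialUnitaryGroup (Fin 2) ℂ)), |f (coords V)| ≤ M := by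
    obtain ⟨M, hM⟩ := isCompact_univ.exists_bound_of_continuousOn hFc.continuousOn
    exact ⟨M, fun V => by simpa [Real.norm_eq_abs] using hM V (Set.mem_univ V)⟩
  have hκ : 0 < s / (8 * ρ) := by positivity
  have h := measureReal_ge_le_exp_of_entropy_le (wilsonMeasure (d := 3) (L := L) (fundamentalRep (Fin 2)) β') hFc.measurable hM hκ
    (fun l' hl' => wilson_entropy_exp_le_of_logSobolev L β' f hf s hρ hLSgen hΓ l' hl') hr
  have e : r ^ 2 / (4 * (s / (8 * ρ))) = 2 * ρ * r ^ 2 / s := by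
    field_simp
    ring
  rw [e] at h
  exact h

/-! ## §2. Transport–entropy inequality and cold-start equilibration from log-Sobolev(`ρ`) -/

/-- ★★ **Transport–entropy inequality from log-Sobolev(`ρ`)**: for `f ∈ C³` with `Γ(f) ≤ s` (`s > 0`) and every probability measure `ν`
with `KL(ν ‖ μ_(β')) < ∞`, `|∫F dν − ∫F dμ_(β')| ≤ √(s · KL(ν ‖ μ_(β'))/(2ρ))`. [cite: BoucheronLugosiMassart2013, Lemma 4.18] -/
theorem wilson_transport_le_sqrt_of_logSobolev (L : ℕ) [NeZero L] (β' : ℝ) {s : ℝ} (hs : 0 < s)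
    (f : (Edge 3 L × Fin 2 × Fin 2 × Bool → ℝ) → ℝ) (hf : ContDiff ℝ 3 f) {ρ : ℝ} (hρ : 0 < ρ)
    (hLSgen : ∀ (f : (Edge 3 L × Fin 2 × Fin 2 × Bool → ℝ) → ℝ), ContDiff ℝ 3 f →
        let coords : GaugeConfig 3 L (Matrix.specialUnitaryGroup (Fin 2) ℂ) → (Edge 3 L × Fin 2 × Fin 2 × Bool → ℝ) :=
          fun V q => (fun z : ℂ => if q.2.2.2 then z.im else z.re)
            ((fundamentalRep (Fin 2) (V q.1) : Matrix (Fin 2) (Fin 2) ℂ) q.2.1 q.2.2.1)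
        let gen : GaugeConfig 3 L (Matrix.specialUnitaryGroup (Fin 2) ℂ) → ℝ := fun V =>
          (∑ i : Edge 3 L × Fin 2 × Fin 2 × Bool, fderiv ℝ f (coords V) (Pi.single i 1) *
              (fun z : ℂ => if i.2.2.2 then z.im else z.re)
                ((latticeLangevinDynamics (fundamentalLatticeRep 2) β').drift
                  (matrixConfig (fundamentalRep (Fin 2)) V) i.1 i.2.1 i.2.2.1) +
          1 / 2 * ∑ i : Edge 3 L × Fin 2 × Fin 2 × Bool, ∑ j : Edge 3 L × Fin 2 × Fin 2 × Bool,
            fderiv ℝ (fun z => fderiv ℝ f z (Pi.single i 1)) (coords V) (Pi.single j 1) *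
              ∑ n : Edge 3 L × NoiseIdx 2,
                (if n.1 = i.1 then (fun z : ℂ => if i.2.2.2 then z.im else z.re)
                  ((latticeLangevinDynamics (fundamentalLatticeRep 2) β').noise
                    (matrixConfig (fundamentalRep (Fin 2)) V) i.1 n.2 i.2.1 i.2.2.1) else 0) *
                (if n.1 = j.1 then (fun z : ℂ => if j.2.2.2 then z.im else z.re)
                  ((latticeLangevinDynamics (fundamentalLatticeRep 2) β').noise
                    (matrixConfig (fundamentalRep (Fin 2)) V) j.1 n.2 j.2.1 j.2.2.1) else 0))
        ρ * ((∫ V, f (coords V) ^ 2 * Real.log (f (coords V) ^ 2) ∂(wilsonMeasure (d := 3) (L := L) (fundamentalRep (Fin 2)) β')) -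
            (∫ V, f (coords V) ^ 2 ∂(wilsonMeasure (d := 3) (L := L) (fundamentalRep (Fin 2)) β')) *
              Real.log (∫ V, f (coords V) ^ 2 ∂(wilsonMeasure (d := 3) (L := L) (fundamentalRep (Fin 2)) β'))) ≤
          -∫ V, f (coords V) * gen V ∂(wilsonMeasure (d := 3) (L := L) (fundamentalRep (Fin 2)) β')) :
    let coords : GaugeConfig 3 L (Matrix.specialUnitaryGroup (Fin 2) ℂ) → (Edge 3 L × Fin 2 × Fin 2 × Bool → ℝ) :=
      fun V q => (fun z : ℂ => if q.2.2.2 then z.im else z.re)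
        ((fundamentalRep (Fin 2) (V q.1) : Matrix (Fin 2) (Fin 2) ℂ) q.2.1 q.2.2.1)
    let A : GaugeConfig 3 L (Matrix.specialUnitaryGroup (Fin 2) ℂ) → (Edge 3 L × Fin 2 × Fin 2 × Bool) →
        (Edge 3 L × Fin 2 × Fin 2 × Bool) → ℝ := fun V i j =>
      ∑ n : Edge 3 L × NoiseIdx 2,
        (if n.1 = i.1 then (fun z : ℂ => if i.2.2.2 then z.im else z.re)
          ((latticeLangevinDynamics (fundamentalLatticeRep 2) β').noise
            (matrixConfig (fundamentalRep (Fin 2)) V) i.1 n.2 i.2.1 i.2.2.1) else 0) *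
        (if n.1 = j.1 then (fun z : ℂ => if j.2.2.2 then z.im else z.re)
          ((latticeLangevinDynamics (fundamentalLatticeRep 2) β').noise
            (matrixConfig (fundamentalRep (Fin 2)) V) j.1 n.2 j.2.1 j.2.2.1) else 0)
    (∀ V, (∑ i : Edge 3 L × Fin 2 × Fin 2 × Bool, ∑ j : Edge 3 L × Fin 2 × Fin 2 × Bool, fderiv ℝ f (coords V) (Pi.single i 1) * fderiv ℝ f (coords V) (Pi.single j 1) * A V i j) ≤ s) →
      ∀ (ν : Measure (GaugeConfig 3 L (Matrix.specialUnitaryGroup (Fin 2) ℂ))) [IsProbabilityMeasure ν],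
        klDiv ν (wilsonMeasure (d := 3) (L := L) (fundamentalRep (Fin 2)) β') ≠ ∞ →
        |(∫ V, f (coords V) ∂ν) - ∫ V, f (coords V) ∂(wilsonMeasure (d := 3) (L := L) (fundamentalRep (Fin 2)) β')| ≤
          Real.sqrt (s * (klDiv ν (wilsonMeasure (d := 3) (L := L) (fundamentalRep (Fin 2)) β')).toReal / (2 * ρ)) := by
  intro coords A hΓ ν hν hfin
  classical
  haveI := secondCountableTopology_su2
  haveI := borelSpace_config L
  haveI : IsProbabilityMeasure (wilsonMeasure (d := 3) (L := L) (fundamentalRep (Fin 2)) β') :=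
    isProbabilityMeasure_wilsonMeasure (d := 3) (L := L) (fundamentalRep (Fin 2)) (continuous_fundamentalRep (Fin 2)) β'
  have hco : Continuous coords := continuous_coords (L := L)
  have hFc : Continuous fun V => f (coords V) := hf.continuous.comp hco
  obtain ⟨M, hM⟩ : ∃ M, ∀ V : (GaugeConfig 3 L (Matrix.specialUnitaryGroup (Fin 2) ℂ)), |f (coords V)| ≤ M := by
    obtain ⟨M, hM⟩ := isCompact_univ.exists_bound_of_continuousOn hFc.continuousOn
    exact ⟨M, fun V => by simpa [Real.norm_eq_abs] using hM V (Set.mem_univ V)⟩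
  have hv : 0 < s / (4 * ρ) := by positivity
  have hmgf : ∀ t : ℝ, Real.log (∫ V, Real.exp (t * (f (coords V) - ∫ V', f (coords V') ∂(wilsonMeasure (d := 3) (L := L) (fundamentalRep (Fin 2)) β'))) ∂(wilsonMeasure (d := 3) (L := L) (fundamentalRep (Fin 2)) β')) ≤
      s / (4 * ρ) * t ^ 2 / 2 := fun t => wilson_logmgf_le_of_logSobolev L β' hρ s f hf hLSgen hΓ t
  have h := Literature.Probability.Entropy.abs_integral_sub_integral_le_sqrt_of_subGaussian
    (μ := (wilsonMeasure (d := 3) (L := L) (fundamentalRep (Fin 2)) β')) hFc.measurable hM hv hmgf hfin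
  have e : 2 * (s / (4 * ρ)) * (klDiv ν (wilsonMeasure (d := 3) (L := L) (fundamentalRep (Fin 2)) β')).toReal = s * (klDiv ν (wilsonMeasure (d := 3) (L := L) (fundamentalRep (Fin 2)) β')).toReal / (2 * ρ) := by
    field_simp
    ring
  rw [e] at h
  exact h

/-- ★★★ **Cold-start equilibration of a smooth observable from log-Sobolev(`ρ`)** (every coupling `β'`): for `f ∈ C³` with `Γ(f) ≤ s` (`s > 0`),
every solution `U` of the SU(2) SZZ dynamics from a deterministic start on any probability space, every `τ₀ > 0` and `u ≥ 0`,
`|E f(coords U_(τ₀+u)) − ∫ f∘coords dμ_(β')| ≤ e^(−2ρu) · √(s · KL(law U_(τ₀) ‖ μ_(β'))/(2ρ))`.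
[cite: BakryGentilLedoux2014, Thm 5.2.1] -/
theorem wilson_coldStart_smooth_le_exp_of_logSobolev (L : ℕ) [NeZero L] (β' : ℝ) {ρ : ℝ} (hρ : 0 < ρ)
    (f : (Edge 3 L × Fin 2 × Fin 2 × Bool → ℝ) → ℝ) (hf : ContDiff ℝ 3 f) {s : ℝ} (hs : 0 < s)
    (hLSgen : ∀ (f : (Edge 3 L × Fin 2 × Fin 2 × Bool → ℝ) → ℝ), ContDiff ℝ 3 f →
        let coords : GaugeConfig 3 L (Matrix.specialUnitaryGroup (Fin 2) ℂ) → (Edge 3 L × Fin 2 × Fin 2 × Bool → ℝ) :=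
          fun V q => (fun z : ℂ => if q.2.2.2 then z.im else z.re)
            ((fundamentalRep (Fin 2) (V q.1) : Matrix (Fin 2) (Fin 2) ℂ) q.2.1 q.2.2.1)
        let gen : GaugeConfig 3 L (Matrix.specialUnitaryGroup (Fin 2) ℂ) → ℝ := fun V =>
          (∑ i : Edge 3 L × Fin 2 × Fin 2 × Bool, fderiv ℝ f (coords V) (Pi.single i 1) *
              (fun z : ℂ => if i.2.2.2 then z.im else z.re)
                ((latticeLangevinDynamics (fundamentalLatticeRep 2) β').drift
                  (matrixConfig (fundamentalRep (Fin 2)) V) i.1 i.2.1 i.2.2.1) +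
          1 / 2 * ∑ i : Edge 3 L × Fin 2 × Fin 2 × Bool, ∑ j : Edge 3 L × Fin 2 × Fin 2 × Bool,
            fderiv ℝ (fun z => fderiv ℝ f z (Pi.single i 1)) (coords V) (Pi.single j 1) *
              ∑ n : Edge 3 L × NoiseIdx 2,
                (if n.1 = i.1 then (fun z : ℂ => if i.2.2.2 then z.im else z.re)
                  ((latticeLangevinDynamics (fundamentalLatticeRep 2) β').noise
                    (matrixConfig (fundamentalRep (Fin 2)) V) i.1 n.2 i.2.1 i.2.2.1) else 0) *
                (if n.1 = j.1 then (fun z : ℂ => if j.2.2.2 then z.im else z.re)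
                  ((latticeLangevinDynamics (fundamentalLatticeRep 2) β').noise
                    (matrixConfig (fundamentalRep (Fin 2)) V) j.1 n.2 j.2.1 j.2.2.1) else 0))
        ρ * ((∫ V, f (coords V) ^ 2 * Real.log (f (coords V) ^ 2) ∂(wilsonMeasure (d := 3) (L := L) (fundamentalRep (Fin 2)) β')) -
            (∫ V, f (coords V) ^ 2 ∂(wilsonMeasure (d := 3) (L := L) (fundamentalRep (Fin 2)) β')) *
              Real.log (∫ V, f (coords V) ^ 2 ∂(wilsonMeasure (d := 3) (L := L) (fundamentalRep (Fin 2)) β'))) ≤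
          -∫ V, f (coords V) * gen V ∂(wilsonMeasure (d := 3) (L := L) (fundamentalRep (Fin 2)) β'))
    {Ω : Type} [MeasurableSpace Ω] {P : Measure Ω} [IsProbabilityMeasure P]
    {W : ℝ≥0 → Ω → (Edge 3 L × NoiseIdx 2 → ℝ)} (hW : IsFlatBrownian W P)
    {U : ℝ≥0 → Ω → GaugeConfig 3 L (Matrix.specialUnitaryGroup (Fin 2) ℂ)}
    (z : GaugeConfig 3 L (Matrix.specialUnitaryGroup (Fin 2) ℂ)) (hU0 : ∀ ω, U 0 ω = z)
    (hU : (latticeLangevinDynamics (fundamentalLatticeRep 2) β').IsSolution (fundamentalRep (Fin 2)) hW.natFiltration P W U)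
    {τ₀ : ℝ≥0} (hτ₀ : 0 < (τ₀ : ℝ)) (u : ℝ≥0) :
    let coords : GaugeConfig 3 L (Matrix.specialUnitaryGroup (Fin 2) ℂ) → (Edge 3 L × Fin 2 × Fin 2 × Bool → ℝ) :=
      fun V q => (fun z : ℂ => if q.2.2.2 then z.im else z.re)
        ((fundamentalRep (Fin 2) (V q.1) : Matrix (Fin 2) (Fin 2) ℂ) q.2.1 q.2.2.1)
    let A : GaugeConfig 3 L (Matrix.specialUnitaryGroup (Fin 2) ℂ) → (Edge 3 L × Fin 2 × Fin 2 × Bool) →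
        (Edge 3 L × Fin 2 × Fin 2 × Bool) → ℝ := fun V i j =>
      ∑ n : Edge 3 L × NoiseIdx 2,
        (if n.1 = i.1 then (fun z : ℂ => if i.2.2.2 then z.im else z.re)
          ((latticeLangevinDynamics (fundamentalLatticeRep 2) β').noise
            (matrixConfig (fundamentalRep (Fin 2)) V) i.1 n.2 i.2.1 i.2.2.1) else 0) *
        (if n.1 = j.1 then (fun z : ℂ => if j.2.2.2 then z.im else z.re)
          ((latticeLangevinDynamics (fundamentalLatticeRep 2) β').noise
            (matrixConfig (fundamentalRep (Fin 2)) V) j.1 n.2 j.2.1 j.2.2.1) else 0)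
    (∀ V, (∑ i : Edge 3 L × Fin 2 × Fin 2 × Bool, ∑ j : Edge 3 L × Fin 2 × Fin 2 × Bool, fderiv ℝ f (coords V) (Pi.single i 1) * fderiv ℝ f (coords V) (Pi.single j 1) * A V i j) ≤ s) →
      |(∫ ω, f (coords (U (τ₀ + u) ω)) ∂P) - ∫ V, f (coords V) ∂(wilsonMeasure (d := 3) (L := L) (fundamentalRep (Fin 2)) β')| ≤
        Real.exp (-(2 * ρ) * u) * Real.sqrt (s * (klDiv (P.map (U τ₀)) (wilsonMeasure (d := 3) (L := L) (fundamentalRep (Fin 2)) β')).toReal / (2 * ρ)) := by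
  intro coords A hΓ
  classical
  haveI := secondCountableTopology_su2
  haveI := borelSpace_config L
  haveI : IsProbabilityMeasure (wilsonMeasure (d := 3) (L := L) (fundamentalRep (Fin 2)) β') :=
    isProbabilityMeasure_wilsonMeasure (d := 3) (L := L) (fundamentalRep (Fin 2)) (continuous_fundamentalRep (Fin 2)) β'
  have hco : Continuous coords := continuous_coords (L := L)
  have hFc : Continuous fun V => f (coords V) := hf.continuous.comp hco
  have hmU : ∀ t : ℝ≥0, Measurable (U t) := fun t => (hU.adapted t).mono (hW.natFiltration.le t) le_rfl
  haveI : IsProbabilityMeasure (P.map (U (τ₀ + u))) := Measure.isProbabilityMeasure_map (hmU _).aemeasurable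
  have hdec := klDiv_map_le_exp_of_generatorLogSobolev L β' hρ hLSgen hW z hU0 hU hτ₀ u
  have hfin : klDiv (P.map (U (τ₀ + u))) (wilsonMeasure (d := 3) (L := L) (fundamentalRep (Fin 2)) β') ≠ ∞ :=
    ne_top_of_le_ne_top ENNReal.ofReal_ne_top hdec
  have hT := wilson_transport_le_sqrt_of_logSobolev L β' hs f hf hρ hLSgen hΓ (P.map (U (τ₀ + u))) hfin
  rw [integral_map (hmU _).aemeasurable hFc.measurable.aestronglyMeasurable] at hT
  refine hT.trans ?_
  have hK0 : 0 ≤ (klDiv (P.map (U τ₀)) (wilsonMeasure (d := 3) (L := L) (fundamentalRep (Fin 2)) β')).toReal := ENNReal.toReal_nonneg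
  have hle : (klDiv (P.map (U (τ₀ + u))) (wilsonMeasure (d := 3) (L := L) (fundamentalRep (Fin 2)) β')).toReal ≤
      Real.exp (-4 * ρ * u) * (klDiv (P.map (U τ₀)) (wilsonMeasure (d := 3) (L := L) (fundamentalRep (Fin 2)) β')).toReal := by
    have h := ENNReal.toReal_mono ENNReal.ofReal_ne_top hdec
    rwa [ENNReal.toReal_ofReal (mul_nonneg (Real.exp_pos _).le hK0)] at h
  have h2ρ : 0 < 2 * ρ := by positivity
  have hsq : Real.sqrt (s * (klDiv (P.map (U (τ₀ + u))) (wilsonMeasure (d := 3) (L := L) (fundamentalRep (Fin 2)) β')).toReal / (2 * ρ)) ≤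
      Real.sqrt (s * (Real.exp (-4 * ρ * u) * (klDiv (P.map (U τ₀)) (wilsonMeasure (d := 3) (L := L) (fundamentalRep (Fin 2)) β')).toReal) / (2 * ρ)) :=
    Real.sqrt_le_sqrt (div_le_div_of_nonneg_right (mul_le_mul_of_nonneg_left hle hs.le) h2ρ.le)
  refine hsq.trans (le_of_eq ?_)
  have hexp : Real.exp (-4 * ρ * (u : ℝ)) = (Real.exp (-(2 * ρ) * u)) ^ 2 := by
    rw [sq, ← Real.exp_add]; congr 1; ring
  rw [hexp, show s * ((Real.exp (-(2 * ρ) * (u : ℝ))) ^ 2 * (klDiv (P.map (U τ₀)) (wilsonMeasure (d := 3) (L := L) (fundamentalRep (Fin 2)) β')).toReal) / (2 * ρ) =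
      (Real.exp (-(2 * ρ) * (u : ℝ))) ^ 2 * (s * (klDiv (P.map (U τ₀)) (wilsonMeasure (d := 3) (L := L) (fundamentalRep (Fin 2)) β')).toReal / (2 * ρ)) by ring,
    Real.sqrt_mul' _ (div_nonneg (mul_nonneg hs.le hK0) h2ρ.le), Real.sqrt_sq (Real.exp_pos _).le]

/-- ★★★ **Cold-start equilibration of a smooth observable from log-Sobolev(`ρ`) with the EXPLICIT budget** (`τ₀ = 2`, every `β'`):
`|E f(coords U_(2+u)) − ∫ f∘coords dμ_(β')| ≤ e^(−2ρu) · √(s · (366|β'|L³ + 3 log(3/2) L³ + log 2)/(2ρ))`.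
[cite: BakryGentilLedoux2014, Thm 5.2.1] -/
theorem wilson_coldStart_smooth_le_exp_of_logSobolev_explicit (L : ℕ) [NeZero L] (β' : ℝ)
    (f : (Edge 3 L × Fin 2 × Fin 2 × Bool → ℝ) → ℝ) {ρ : ℝ} (hρ : 0 < ρ) (hf : ContDiff ℝ 3 f) {s : ℝ} (hs : 0 < s)
    (hLSgen : ∀ (f : (Edge 3 L × Fin 2 × Fin 2 × Bool → ℝ) → ℝ), ContDiff ℝ 3 f →
        let coords : GaugeConfig 3 L (Matrix.specialUnitaryGroup (Fin 2) ℂ) → (Edge 3 L × Fin 2 × Fin 2 × Bool → ℝ) :=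
          fun V q => (fun z : ℂ => if q.2.2.2 then z.im else z.re)
            ((fundamentalRep (Fin 2) (V q.1) : Matrix (Fin 2) (Fin 2) ℂ) q.2.1 q.2.2.1)
        let gen : GaugeConfig 3 L (Matrix.specialUnitaryGroup (Fin 2) ℂ) → ℝ := fun V =>
          (∑ i : Edge 3 L × Fin 2 × Fin 2 × Bool, fderiv ℝ f (coords V) (Pi.single i 1) *
              (fun z : ℂ => if i.2.2.2 then z.im else z.re)
                ((latticeLangevinDynamics (fundamentalLatticeRep 2) β').drift
                  (matrixConfig (fundamentalRep (Fin 2)) V) i.1 i.2.1 i.2.2.1) +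
          1 / 2 * ∑ i : Edge 3 L × Fin 2 × Fin 2 × Bool, ∑ j : Edge 3 L × Fin 2 × Fin 2 × Bool,
            fderiv ℝ (fun z => fderiv ℝ f z (Pi.single i 1)) (coords V) (Pi.single j 1) *
              ∑ n : Edge 3 L × NoiseIdx 2,
                (if n.1 = i.1 then (fun z : ℂ => if i.2.2.2 then z.im else z.re)
                  ((latticeLangevinDynamics (fundamentalLatticeRep 2) β').noise
                    (matrixConfig (fundamentalRep (Fin 2)) V) i.1 n.2 i.2.1 i.2.2.1) else 0) *
                (if n.1 = j.1 then (fun z : ℂ => if j.2.2.2 then z.im else z.re)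
                  ((latticeLangevinDynamics (fundamentalLatticeRep 2) β').noise
                    (matrixConfig (fundamentalRep (Fin 2)) V) j.1 n.2 j.2.1 j.2.2.1) else 0))
        ρ * ((∫ V, f (coords V) ^ 2 * Real.log (f (coords V) ^ 2) ∂(wilsonMeasure (d := 3) (L := L) (fundamentalRep (Fin 2)) β')) -
            (∫ V, f (coords V) ^ 2 ∂(wilsonMeasure (d := 3) (L := L) (fundamentalRep (Fin 2)) β')) *
              Real.log (∫ V, f (coords V) ^ 2 ∂(wilsonMeasure (d := 3) (L := L) (fundamentalRep (Fin 2)) β'))) ≤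
          -∫ V, f (coords V) * gen V ∂(wilsonMeasure (d := 3) (L := L) (fundamentalRep (Fin 2)) β'))
    {Ω : Type} [MeasurableSpace Ω] {P : Measure Ω} [IsProbabilityMeasure P]
    {W : ℝ≥0 → Ω → (Edge 3 L × NoiseIdx 2 → ℝ)} (hW : IsFlatBrownian W P)
    {U : ℝ≥0 → Ω → GaugeConfig 3 L (Matrix.specialUnitaryGroup (Fin 2) ℂ)}
    (z : GaugeConfig 3 L (Matrix.specialUnitaryGroup (Fin 2) ℂ)) (hU0 : ∀ ω, U 0 ω = z)
    (hU : (latticeLangevinDynamics (fundamentalLatticeRep 2) β').IsSolution (fundamentalRep (Fin 2)) hW.natFiltration P W U)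
    (u : ℝ≥0) :
    let coords : GaugeConfig 3 L (Matrix.specialUnitaryGroup (Fin 2) ℂ) → (Edge 3 L × Fin 2 × Fin 2 × Bool → ℝ) :=
      fun V q => (fun z : ℂ => if q.2.2.2 then z.im else z.re)
        ((fundamentalRep (Fin 2) (V q.1) : Matrix (Fin 2) (Fin 2) ℂ) q.2.1 q.2.2.1)
    let A : GaugeConfig 3 L (Matrix.specialUnitaryGroup (Fin 2) ℂ) → (Edge 3 L × Fin 2 × Fin 2 × Bool) →
        (Edge 3 L × Fin 2 × Fin 2 × Bool) → ℝ := fun V i j =>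
      ∑ n : Edge 3 L × NoiseIdx 2,
        (if n.1 = i.1 then (fun z : ℂ => if i.2.2.2 then z.im else z.re)
          ((latticeLangevinDynamics (fundamentalLatticeRep 2) β').noise
            (matrixConfig (fundamentalRep (Fin 2)) V) i.1 n.2 i.2.1 i.2.2.1) else 0) *
        (if n.1 = j.1 then (fun z : ℂ => if j.2.2.2 then z.im else z.re)
          ((latticeLangevinDynamics (fundamentalLatticeRep 2) β').noise
            (matrixConfig (fundamentalRep (Fin 2)) V) j.1 n.2 j.2.1 j.2.2.1) else 0)
    (∀ V, (∑ i : Edge 3 L × Fin 2 × Fin 2 × Bool, ∑ j : Edge 3 L × Fin 2 × Fin 2 × Bool, fderiv ℝ f (coords V) (Pi.single i 1) * fderiv ℝ f (coords V) (Pi.single j 1) * A V i j) ≤ s) →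
      |(∫ ω, f (coords (U ((2 : ℝ≥0) + u) ω)) ∂P) - ∫ V, f (coords V) ∂(wilsonMeasure (d := 3) (L := L) (fundamentalRep (Fin 2)) β')| ≤
        Real.exp (-(2 * ρ) * u) * Real.sqrt (s * (366 * |β'| * (L : ℝ) ^ 3 + 3 * Real.log (3 / 2) * (L : ℝ) ^ 3 + Real.log 2) / (2 * ρ)) := by
  intro coords A hΓ
  have ht₁ : 0 < ((2 : ℝ≥0) : ℝ) := by norm_num
  have h := wilson_coldStart_smooth_le_exp_of_logSobolev L β' hρ f hf hs hLSgen hW z hU0 hU ht₁ u hΓ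
  have hb := wilson_klDiv_map_le_explicit L β' z hW hU0 hU 0
  rw [add_zero] at hb
  have hBpos := burnInBudget_pos L β'
  have hK : (klDiv (P.map (U (2 : ℝ≥0))) (wilsonMeasure (d := 3) (L := L) (fundamentalRep (Fin 2)) β')).toReal ≤ (366 * |β'| * (L : ℝ) ^ 3 + 3 * Real.log (3 / 2) * (L : ℝ) ^ 3 + Real.log 2) := by
    have h' := ENNReal.toReal_mono ENNReal.ofReal_ne_top hb
    rwa [ENNReal.toReal_ofReal hBpos.le] at h'
  have h2ρ : 0 < 2 * ρ := by positivity
  refine h.trans (mul_le_mul_of_nonneg_left (Real.sqrt_le_sqrt ?_) (Real.exp_pos _).le)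
  exact div_le_div_of_nonneg_right (mul_le_mul_of_nonneg_left hK hs.le) h2ρ.le

end Summit.QuantumFields.YangMills.Theorems.ColdStartUniversality
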